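import Summits.CriticalPhenomena.PercolationContinuityZ3.Theorems.PercNearOneGluingNoHeavyLowerTailSahiGridPatternDiagCertLift

/-!
# `NoHeavyLowerTail` (crux stmt-CriticalPhenomena-4575), Sahi programme P1: **THE DIAGONAL-CERTIFICATE OBLIGATION `DiagCertifiable k`**
# (conjecture `(†_diag)_k`) and its consequences: `PatternPos k`, every junta cylinder good in every dimension, Kahn's Conjecture 5

Support file (Sahi cell, seat `prim-sahi-p1`, generation 16; `--supports stmt-CriticalPhenomena-4575`).  One `@[conjecture]` definition (an
obligation, used only as an explicit hypothesis), pure consequences, no `sorry`, standard axioms.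

THE MATHEMATICS.  `DiagCertifiable k` :⟺ every up-set `U ⊆ [3]^k` admits `d : [3]^k → ℤ`, `d ≥ 0`, with (T) `Σ_{q∈W} d(q) ≤ Σ_{q∈W} λ_U(q)` for
every up-set `W` and (N) `Σ_{A×A′} Θ_U ≤ Σ_{A∩A′} d` for all up-sets `A, A′` — a linear feasibility problem in `3^k` unknowns per `U` whose two
constraint families are separable by min-weight closures.  STATUS (seat computation, generation 16, exact, two engines): TRUE for `k ≤ 3` (all
3 + 19 + 979 nonempty up-sets; integer certificates), OPEN for `k ≥ 4` (partial: principal `U` with the trivial `d = 2^k·1_U` at `k = 4`, exhaustive;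
further `k = 4` classes by kit jobs recorded in the seat memo).  CONSEQUENCES (this file): `DiagCertifiable k → PatternPos k`
(`patternPos_of_diagCertifiable`); `DiagCertifiable k →` every cylinder `U × [3]^n`, `U ⊆ [3]^k` an up-set, is a good first slot in dimension
`n + k` (`sStarD_cylSet_nonneg_of_diagCertifiable`); `DiagCertifiable k → DiagCertifiable`-type certificates for all cylinders (`…Lift`);
`(∀ k, DiagCertifiable k) → KahnConjecture` (`kahnConjecture_of_forall_diagCertifiable`).  Nothing here asserts `DiagCertifiable k` for any `k`.
[this work]
-/

namespace Summit.CriticalPhenomena.PercolationContinuityZ3.Theorems.SahiGridPattern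

open Finset SahiGrid3
open scoped BigOperators

variable {n k : ℕ}

/-- **`DiagCertifiable k`** — the DIAGONAL-CERTIFICATE OBLIGATION `(†_diag)_k`: every up-set `U ⊆ [3]^k` has a nonnegative `d` on `[3]^k` with
(T) `Σ_{q∈W} d(q) ≤ Σ_{q∈W} λ_U(q)` for every up-set `W` and (N) `Σ_{q∈A}Σ_{r∈A′} Θ_U(q,r) ≤ Σ_{q∈A∩A′} d(q)` for all up-sets `A, A′`.
An obligation / hypothesis, never used as a fact. [this work] [status: exhaustive (exact) for k ≤ 3; open for k ≥ 4] -/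
@[conjecture] def DiagCertifiable (k : ℕ) : Prop :=
  ∀ U : Finset (Pd k), IsUpperSet (U : Set (Pd k)) → ∃ d : Pd k → ℤ, (∀ q, 0 ≤ d q) ∧
    (∀ W : Finset (Pd k), IsUpperSet (W : Set (Pd k)) → (∑ q ∈ W, d q) ≤ ∑ q ∈ W, lamU U q) ∧
    (∀ A A' : Finset (Pd k), IsUpperSet (A : Set (Pd k)) → IsUpperSet (A' : Set (Pd k)) →
      (∑ q ∈ A, ∑ r ∈ A', thetaVal U q r) ≤ ∑ q ∈ A ∩ A', d q)

/-- `DiagCertifiable k ⟹ PatternPos k`. [this work] -/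
theorem patternPos_of_diagCertifiable (h : DiagCertifiable k) : PatternPos k :=
  patternPos_of_forall_diagCert fun U hU => by
    obtain ⟨d, _, hT, hN⟩ := h U hU
    exact ⟨d, hT, hN⟩

/-- `DiagCertifiable k ⟹` every junta cylinder `U × [3]^n` over an up-set `U ⊆ [3]^k` is a good first slot of the pattern functional in
dimension `n + k`, for every `n`. [this work] -/
theorem sStarD_cylSet_nonneg_of_diagCertifiable (h : DiagCertifiable k) {U : Finset (Pd k)} (hU : IsUpperSet (U : Set (Pd k)))
    {B C : Finset (Pd (n + k))} (hB : IsUpperSet (B : Set (Pd (n + k)))) (hC : IsUpperSet (C : Set (Pd (n + k)))) :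
    0 ≤ sStarD (cylSet U : Finset (Pd (n + k))) B C := by
  obtain ⟨d, hd, hT, hN⟩ := h U hU
  exact sStarD_cylSet_nonneg_of_diagCert U d hd hT hN hB hC

/-- `DiagCertifiable k ⟹` every cylinder `U × [3]^n` (as an up-set of `[3]^{n+k}`) itself admits a diagonal certificate (the free lift). [this work] -/
theorem exists_diagCert_cylSet_of_diagCertifiable (h : DiagCertifiable k) {U : Finset (Pd k)} (hU : IsUpperSet (U : Set (Pd k))) :
    ∃ d' : Pd (n + k) → ℤ, (∀ x, 0 ≤ d' x) ∧
      (∀ W : Finset (Pd (n + k)), IsUpperSet (W : Set (Pd (n + k))) →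
        (∑ x ∈ W, d' x) ≤ ∑ x ∈ W, lamU (cylSet U : Finset (Pd (n + k))) x) ∧
      (∀ A B : Finset (Pd (n + k)), IsUpperSet (A : Set (Pd (n + k))) → IsUpperSet (B : Set (Pd (n + k))) →
        (∑ x ∈ A, ∑ y ∈ B, thetaVal (cylSet U : Finset (Pd (n + k))) x y) ≤ ∑ x ∈ A ∩ B, d' x) :=
  exists_diagCert_cylSet U (h U hU)

/-- **`(∀ k, DiagCertifiable k) ⟹ Kahn's Conjecture 5`** (through `PatternPos` in every dimension). [this work] -/
theorem kahnConjecture_of_forall_diagCertifiable (h : ∀ k, DiagCertifiable k) : KahnConjecture :=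
  kahnConjecture_of_forall_patternPos fun d => patternPos_of_diagCertifiable (h d)

/-- The obligation holds in dimension `0` (the one-point cube: `U ∈ {∅, ⊤}`, `d ≡ 1_U`). [this work] -/
theorem diagCertifiable_zero : DiagCertifiable 0 := by
  intro U hU
  refine ⟨fun q => ind U q, fun q => by show 0 ≤ ind U q; unfold ind; split_ifs <;> norm_num, fun W _ => ?_, fun A A' _ _ => ?_⟩
  · refine Finset.sum_le_sum fun q _ => ?_
    unfold lamU nuCount ind
    have h0 : ((U.filter fun p => TotDist p q = true).card : ℤ) ≤ 1 := by
      have : (U.filter fun p => TotDist p q = true).card ≤ (univ : Finset (Pd 0)).card :=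
        Finset.card_le_card (Finset.subset_univ _)
      have hu : (univ : Finset (Pd 0)).card = 1 := by simp
      exact_mod_cast this.trans hu.le
    have h1 : (0 : ℤ) ≤ ((U.filter fun p => TotDist p q = true).card : ℤ) := by exact_mod_cast Nat.zero_le _
    split_ifs with hq
    · simp only [pow_zero]; linarith
    · have : (U.filter fun p => TotDist p q = true).card = 0 := by
        rw [Finset.card_eq_zero, Finset.filter_eq_empty_iff]
        intro p hp
        have hpq : p = q := Subsingleton.elim p q
        exact absurd (hpq ▸ hp) hq
      simp [this]
  · -- in dimension 0 every two points are equal and totally distinct (vacuously); Θ_U(q,q) = 1_U(q) + 1_U(q) − 1_U(q) = 1_U(q)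
    have hpt : ∀ q r : Pd 0, q = r := fun q r => Subsingleton.elim q r
    have htd : ∀ q r : Pd 0, TotDist q r = true := fun q r => by rw [totDist_iff]; intro a; exact a.elim0
    have hth : ∀ q r : Pd 0, thetaVal U q r = ind U q := by
      intro q r
      unfold thetaVal
      rw [if_pos (htd q r), hpt r q, hpt (thirdPt q q) q]
      ring
    simp_rw [hth]
    -- Σ_{q∈A} Σ_{r∈A'} 1_U(q) ≤ Σ_{q∈A∩A'} 1_U(q): both sides are over subsets of the one-point type
    rcases Finset.eq_empty_or_nonempty A' with hA' | hA'
    · simp only [hA', Finset.sum_empty, Finset.sum_const_zero, Finset.inter_empty]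
      exact le_refl _
    · have hA'u : A' = univ := by
        ext r; simp only [mem_univ, iff_true]
        obtain ⟨r0, hr0⟩ := hA'; rwa [hpt r r0]
      subst hA'u
      have hcard : (univ : Finset (Pd 0)).card = 1 := by simp
      simp only [Finset.sum_const, hcard, one_smul, Finset.inter_univ]
      exact le_rfl

end Summit.CriticalPhenomena.PercolationContinuityZ3.Theorems.SahiGridPattern
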